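import Literature.MathematicalPhysics.QuantumFieldTheory.QCDSiteRPFrame
import Literature.MathematicalPhysics.QuantumLattice.GrassmannGaussianPairing
import Literature.MathematicalPhysics.QuantumLattice.GrassmannSiteReflectionPairing
import Mathlib.LinearAlgebra.Matrix.PosDef
import HarnessLib

/-!
# The reflection slice of the site reflection: upper variables, their embedding, the slice coupling

Companion of `QCDSiteRPFrame` for the site-reflection positivity proof of lattice QCD with Wilson
quarks (Montvay–Münster 1994 §4.2.3 (4.100)–(4.110); Lüscher 1977).  On the odd torus the reflection
slice is `t = 0`; in the `γ₀`-diagonal frame its UPPER generators (`upperGens`: `ψ_{x,r}` with `r < 2`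
and `ψ̄_{x,r}` with `r ≥ 2`, Montvay–Münster's `ξ`, `η` of (4.102)) are the slice variables through
which the positive-time algebra is coupled to the negative-time algebra, by the Gaussian slice weight
`exp(Σ l A' u)` of (4.109) whose matrix `B` (4.110) is positive definite.  This file supplies

* `SliceIdx Nf L = Fin Nf × (ℤ/L)³ × Fin 3 × Fin 4` and the embedding `SliceIdx.emb` onto `upperGens`
  (`upperGens_eq_image`), with the linear order pulled back along it (so `emb` is strictly monotone
  and `map slicePhi (psiProd I) = θ_{emb(I)}`, `map_slicePhi_psiProd`);
* the substitution `slicePhi` realising the abstract two-species calculus of `GrassmannGaussianPairing`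
  on the slice: `map slicePhi (ψ_k) = gen (emb k) = u_k`, `map slicePhi (ψ̄_k) = Θ' u_k = l_k`
  (`map_slicePhi_psi`, `map_slicePhi_psiBar`, `fermiThetaRot_map_slicePhi_psi`);
* the spatial hopping matrices `hopT U j` of the slice (unitary: `conjTranspose_hopT_mul_self`), the
  matrix `sliceB U m = (m+1)·1 + ½ Σ_j (1 − T_j)ᴴ(1 − T_j)` — Montvay–Münster's `B` of (4.110) in its
  manifestly positive form — `posDef_sliceB` (`m > −1`) and its entries `sliceB_apply`
  (`= (m+4)δ − ½Σ_j (T_j + T_jᴴ)`);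
* the slice coupling `sliceK U mq` on `SliceIdx` (flavour- and spin-diagonal, `2B` on `r < 2`, `2Bᵀ`
  on `r ≥ 2`): `posDef_sliceK`, `isUnit_det_sliceK`, `posSemidef_inv_sliceK`, `inv_neg_eq`.

The identification of `sliceK` with the slice block of the rotated Wilson action is made in the sequel.
References: Montvay–Münster (4.102), (4.109)–(4.110); M. Lüscher, Commun. Math. Phys. 54 (1977) 283,
§3. Everything here is proved; no named fact. [folklore]
-/

namespace Literature.MathematicalPhysics.QuantumFieldTheory

open Literature.Probability Literature.Probability.LatticeModels
open Literature.MathematicalPhysics.QuantumLattice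
open Literature.MathematicalPhysics.QuantumLattice.GrassmannAlgebra
open scoped ComplexConjugate ComplexOrder Matrix

noncomputable section

local notation "𝔾" => Matrix.specialUnitaryGroup (Fin 3) ℂ

variable {Nf L : ℕ} [NeZero L]

/-! ## The reflection slice `t = 0` -/

section Site

/-- The site of the slice `t = 0` with spatial coordinates `y`. [folklore] -/
def sliceSite (y : TorusSite 3 L) : TorusSite 4 L := Fin.cons 0 y

omit [NeZero L] in
/-- Its time coordinate is `0`. [folklore] -/
@[simp] theorem sliceSite_apply_zero (y : TorusSite 3 L) : sliceSite y 0 = 0 := rfl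

omit [NeZero L] in
/-- Its spatial coordinates. [folklore] -/
@[simp] theorem sliceSite_apply_succ (y : TorusSite 3 L) (j : Fin 3) : sliceSite y j.succ = y j := by
  simp [sliceSite]

omit [NeZero L] in
/-- `sliceSite` is injective. [folklore] -/
theorem sliceSite_injective : Function.Injective (sliceSite (L := L)) := fun y y' h =>
  funext fun j => by rw [← sliceSite_apply_succ y j, ← sliceSite_apply_succ y' j, h]

omit [NeZero L] in
/-- A site of time `0` is a slice site. [folklore] -/
theorem sliceSite_tail (x : TorusSite 4 L) (hx : x 0 = 0) : sliceSite (Fin.tail x) = x := by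
  rw [sliceSite, ← hx, Fin.cons_self_tail]

omit [NeZero L] in
/-- The site reflection fixes the slice. [folklore] -/
@[simp] theorem negReflect_sliceSite (y : TorusSite 3 L) : Site.negReflect (sliceSite y) = sliceSite y := by
  funext k
  by_cases hk : k = 0
  · subst hk; rw [WilsonSiteRP.negReflect_apply_zero, sliceSite_apply_zero, neg_zero]
  · rw [WilsonSiteRP.negReflect_apply_of_ne _ hk]

omit [NeZero L] in
/-- A spatial shift of a slice site is the slice site of the shifted spatial coordinates. [folklore] -/
theorem shift_sliceSite (y : TorusSite 3 L) (j : Fin 3) :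
    Site.shift (sliceSite y) j.succ = sliceSite (y + Pi.single j 1) := by
  funext k
  refine Fin.cases ?_ (fun i => ?_) k
  · simp [Site.shift, sliceSite]
  · simp only [Site.shift, Pi.add_apply, sliceSite_apply_succ]
    by_cases hi : i = j
    · subst hi; simp
    · rw [Pi.single_eq_of_ne (Fin.succ_injective _ |>.ne hi), Pi.single_eq_of_ne hi]

end Site

/-! ## Slice indices and the embedding onto the upper generators -/

variable (Nf L) in
/-- **Indices of the slice variables**: flavour, spatial site, colour, (rotated) spin. A type synonym
(not an `abbrev`) so that it can carry the linear order pulled back from the generators. [folklore] -/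
def SliceIdx : Type := Fin Nf × TorusSite 3 L × Fin 3 × Fin 4

/-- `SliceIdx` is finite. [folklore] -/
instance : Fintype (SliceIdx Nf L) := inferInstanceAs (Fintype (Fin Nf × TorusSite 3 L × Fin 3 × Fin 4))

namespace SliceIdx

variable (Nf L) in
/-- Constructor. [folklore] -/
def mk (f : Fin Nf) (y : TorusSite 3 L) (a : Fin 3) (r : Fin 4) : SliceIdx Nf L := (f, y, a, r)

/-- The flavour. [folklore] -/
def flav (k : SliceIdx Nf L) : Fin Nf := k.1
/-- The spatial site. [folklore] -/
def site (k : SliceIdx Nf L) : TorusSite 3 L := k.2.1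
/-- The colour. [folklore] -/
def col (k : SliceIdx Nf L) : Fin 3 := k.2.2.1
/-- The spin. [folklore] -/
def spin (k : SliceIdx Nf L) : Fin 4 := k.2.2.2

omit [NeZero L] in
/-- Extensionality. [folklore] -/
theorem ext' {k k' : SliceIdx Nf L} (h1 : k.flav = k'.flav) (h2 : k.site = k'.site) (h3 : k.col = k'.col)
    (h4 : k.spin = k'.spin) : k = k' :=
  Prod.ext h1 (Prod.ext h2 (Prod.ext h3 h4))

/-- The quark variable on the slice with these labels. [folklore] -/
def qvar (k : SliceIdx Nf L) : QuarkVar Nf L := (k.flav, (sliceSite k.site, k.col, k.spin))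

/-- Its index. [folklore] -/
def qidx (k : SliceIdx Nf L) : FermiIdx Nf L := quarkEquiv k.qvar

/-- `qidx` is injective. [folklore] -/
theorem qidx_injective : Function.Injective (qidx (Nf := Nf) (L := L)) := by
  intro k k' h
  have h' : k.qvar = k'.qvar := quarkEquiv.injective h
  simp only [qvar, Prod.mk.injEq] at h'
  exact ext' h'.1 (sliceSite_injective h'.2.1) h'.2.2.1 h'.2.2.2

/-- Spin of the slice variable. [folklore] -/
@[simp] theorem idxSpin_qidx (k : SliceIdx Nf L) : idxSpin k.qidx = k.spin := by simp [qidx, qvar]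

/-- Time of the slice variable. [folklore] -/
@[simp] theorem idxTime_qidx (k : SliceIdx Nf L) : idxTime k.qidx = 0 := by simp [qidx, qvar]

/-- The reflection fixes the slice variables' indices. [folklore] -/
@[simp] theorem idxRefl_qidx (k : SliceIdx Nf L) : idxRefl k.qidx = k.qidx := by
  simp [qidx, qvar]

/-- **The embedding of the slice indices onto the upper generators**: `ψ_{x,a,r}` for `r < 2`,
`ψ̄_{x,a,r}` for `r ≥ 2` (Montvay–Münster's `ξ` and `η`). [cite: MontvayMunster1994, §4.2.3 (4.102)] -/
def emb (k : SliceIdx Nf L) : FermiIdx Nf L ⊕ₗ FermiIdx Nf L :=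
  if (k.spin).val < 2 then toLex (Sum.inr k.qidx) else toLex (Sum.inl k.qidx)

/-- `emb` is injective. [folklore] -/
theorem emb_injective : Function.Injective (emb (Nf := Nf) (L := L)) := by
  intro k k' h
  unfold emb at h
  split_ifs at h with h1 h2 h2
  · exact qidx_injective (Sum.inr_injective (toLex.injective h))
  · cases toLex.injective h
  · cases toLex.injective h
  · exact qidx_injective (Sum.inl_injective (toLex.injective h))

/-- The linear order of the slice indices: pulled back from the generators, so that `emb` is an order
embedding. [folklore] -/
instance : LinearOrder (SliceIdx Nf L) := LinearOrder.lift' emb emb_injective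

/-- `emb` is strictly monotone (by construction). [folklore] -/
theorem emb_strictMono : StrictMono (emb (Nf := Nf) (L := L)) := fun _ _ h => h

/-- `emb` is monotone. [folklore] -/
theorem emb_le_iff {k k' : SliceIdx Nf L} : emb k ≤ emb k' ↔ k ≤ k' := Iff.rfl

/-- The underlying index of `emb k`. [folklore] -/
@[simp] theorem genIdx_emb (k : SliceIdx Nf L) : genIdx (emb k) = k.qidx := by
  unfold emb; split_ifs <;> rfl

/-- `emb k` lives on the slice. [folklore] -/
@[simp] theorem genTimeT_emb (k : SliceIdx Nf L) : genTimeT (emb k) = 0 := by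
  simp [genTimeT]

/-- `emb k` is an upper generator. [folklore] -/
theorem isUpper_emb (k : SliceIdx Nf L) : IsUpper (emb k) := by
  unfold emb
  split_ifs with h
  · rw [isUpper_inr, idxSpin_qidx]; exact h
  · rw [isUpper_inl, idxSpin_qidx]; omega

/-- `emb k ∈ upperGens`. [folklore] -/
theorem emb_mem_upperGens (k : SliceIdx Nf L) : emb k ∈ upperGens Nf L :=
  mem_upperGens.2 ⟨genTimeT_emb k, isUpper_emb k⟩

/-- Every upper generator is an `emb k`. [folklore] -/
theorem exists_emb_eq {w : FermiIdx Nf L ⊕ₗ FermiIdx Nf L} (hw : w ∈ upperGens Nf L) : ∃ k, emb k = w := by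
  rw [mem_upperGens] at hw
  obtain ⟨ht, hu⟩ := hw
  rcases h : ofLex w with i | i
  · have hw : w = toLex (Sum.inl i) := by rw [← h, toLex_ofLex]
    subst hw
    set v := quarkEquiv.symm i with hv
    have hi : i = quarkEquiv v := by simp [hv]
    rw [hi] at ht hu ⊢
    simp only [genTimeT, genIdx_inl, idxTime_quarkEquiv, ZMod.val_eq_zero] at ht
    simp only [isUpper_inl, idxSpin_quarkEquiv] at hu
    refine ⟨(v.1, Fin.tail v.2.1, v.2.2.1, v.2.2.2), ?_⟩
    have hs : ¬ (v.2.2.2).val < 2 := by omega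
    simp only [emb, spin, hs, if_false, qidx, qvar, flav, site, col, sliceSite_tail _ ht]
  · have hw : w = toLex (Sum.inr i) := by rw [← h, toLex_ofLex]
    subst hw
    set v := quarkEquiv.symm i with hv
    have hi : i = quarkEquiv v := by simp [hv]
    rw [hi] at ht hu ⊢
    simp only [genTimeT, genIdx_inr, idxTime_quarkEquiv, ZMod.val_eq_zero] at ht
    simp only [isUpper_inr, idxSpin_quarkEquiv] at hu
    refine ⟨(v.1, Fin.tail v.2.1, v.2.2.1, v.2.2.2), ?_⟩
    simp only [emb, spin, hu, if_true, qidx, qvar, flav, site, col, sliceSite_tail _ ht]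

/-- **The upper generators are exactly the image of `emb`.** [folklore] -/
theorem upperGens_eq_image : upperGens Nf L = Finset.univ.image (emb (Nf := Nf) (L := L)) := by
  ext w
  simp only [Finset.mem_image, Finset.mem_univ, true_and]
  exact ⟨exists_emb_eq, fun ⟨k, hk⟩ => hk ▸ emb_mem_upperGens k⟩

/-- The reflection partner of `emb k` (the lower generator `σ(emb k)` of the slice). [folklore] -/
theorem reflGen_emb (k : SliceIdx Nf L) :
    reflGen (emb k) = if (k.spin).val < 2 then toLex (Sum.inl k.qidx) else toLex (Sum.inr k.qidx) := by
  unfold emb; split_ifs <;> simp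

/-- The sign of `emb k`. [folklore] -/
@[simp] theorem genSign_emb (k : SliceIdx Nf L) : genSign (emb k) = spinSign k.spin := by
  simp [genSign]

/-- A sum over the upper generators is a sum over the slice indices. [folklore] -/
theorem sum_upperGens_eq {M : Type*} [AddCommMonoid M] (g : FermiIdx Nf L ⊕ₗ FermiIdx Nf L → M) :
    ∑ w ∈ upperGens Nf L, g w = ∑ k : SliceIdx Nf L, g (emb k) := by
  rw [upperGens_eq_image, Finset.sum_image fun _ _ _ _ h => emb_injective h]

end SliceIdx

/-! ## The substitution realising the slice calculus -/

section Phi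

open SliceIdx

/-- The images of the abstract generators: `ψ_k ↦ e_{emb k}`, `ψ̄_k ↦ ε • e_{σ(emb k)}`. [folklore] -/
def slicePhiVec : SliceIdx Nf L ⊕ₗ SliceIdx Nf L → (FermiIdx Nf L ⊕ₗ FermiIdx Nf L → ℂ) := fun w =>
  match ofLex w with
  | Sum.inr k => Pi.single (emb k) 1
  | Sum.inl k => genSign (emb k) • Pi.single (reflGen (emb k)) 1

/-- **The substitution** `φ` of the abstract two-species variables into the slice: `ψ_k ↦ u_k = gen (emb k)`,
`ψ̄_k ↦ l_k = Θ' u_k`. [cite: MontvayMunster1994, §4.2.3 (4.102)] -/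
def slicePhi : (SliceIdx Nf L ⊕ₗ SliceIdx Nf L → ℂ) →ₗ[ℂ] (FermiIdx Nf L ⊕ₗ FermiIdx Nf L → ℂ) :=
  Fintype.linearCombination ℂ slicePhiVec

/-- `φ` on a basis vector. [folklore] -/
theorem slicePhi_single (w : SliceIdx Nf L ⊕ₗ SliceIdx Nf L) :
    slicePhi (Pi.single w (1 : ℂ)) = slicePhiVec w := by
  rw [slicePhi, Fintype.linearCombination_apply_single, one_smul]

/-- **`φ(ψ_k) = u_k`.** [folklore] -/
theorem map_slicePhi_psi (k : SliceIdx Nf L) :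
    ExteriorAlgebra.map slicePhi (psi ℂ k) = gen ℂ (emb k) := by
  rw [psi, gen, ExteriorAlgebra.map_apply_ι, slicePhi_single]
  rfl

/-- **`φ(ψ̄_k) = Θ' u_k = l_k`.** [folklore] -/
theorem map_slicePhi_psiBar (k : SliceIdx Nf L) :
    ExteriorAlgebra.map slicePhi (psiBar ℂ k) = fermiThetaRot (gen ℂ (emb k)) := by
  rw [psiBar, gen, ExteriorAlgebra.map_apply_ι, slicePhi_single, fermiThetaRot_gen, gen, ← map_smul]
  rfl

/-- The intertwining `Θ' (φ ψ_k) = φ ψ̄_k`. [folklore] -/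
theorem fermiThetaRot_map_slicePhi_psi (k : SliceIdx Nf L) :
    fermiThetaRot (ExteriorAlgebra.map slicePhi (psi ℂ k)) = ExteriorAlgebra.map slicePhi (psiBar ℂ k) := by
  rw [map_slicePhi_psi, map_slicePhi_psiBar]

/-- Sorting commutes with a strictly monotone map. [folklore] -/
theorem sort_image_emb (I : Finset (SliceIdx Nf L)) :
    (I.image emb).sort (· ≤ ·) = (I.sort (· ≤ ·)).map emb := by
  refine List.Perm.eq_of_sortedLE (Finset.pairwise_sort (I.image emb) (· ≤ ·)).sortedLE ?_ ?_
  · exact (List.pairwise_map.2 ((Finset.pairwise_sort I (· ≤ ·)).imp fun h => emb_le_iff.2 h)).sortedLE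
  · refine List.perm_of_nodup_nodup_toFinset_eq (Finset.sort_nodup _ _)
      ((Finset.sort_nodup _ _).map emb_injective) ?_
    rw [Finset.sort_toFinset]
    ext w
    simp only [Finset.mem_image, List.mem_toFinset, List.mem_map, Finset.mem_sort]

/-- **`φ(ψ_I) = θ_{emb(I)}`**: the increasing product of upper generators is the basis monomial. [folklore] -/
theorem map_slicePhi_psiProd (I : Finset (SliceIdx Nf L)) :
    ExteriorAlgebra.map slicePhi (psiProd (SliceIdx Nf L) I) =
      grassmannBasis ℂ (FermiIdx Nf L ⊕ₗ FermiIdx Nf L) (I.image emb) := by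
  rw [psiProd, map_list_prod, List.map_map, grassmannBasis_eq_prod_map_gen, sort_image_emb, List.map_map]
  congr 1
  refine List.map_congr_left fun k _ => ?_
  simp only [Function.comp_apply]
  exact map_slicePhi_psi k

end Phi

/-! ## The slice coupling: hopping matrices, `B`, positivity -/

section Coupling

variable (U : GaugeConfig 4 L 𝔾)

variable (L) in
/-- Colour-site indices of one spin–flavour component of the slice. [folklore] -/
abbrev ColourSite : Type := TorusSite 3 L × Fin 3

/-- **The spatial hopping matrix of the slice in direction `j`**:
`(T_j)_{(y,a),(y',b)} = [y' = y + e_j] U(y, j)_{ab}`. [cite: MontvayMunster1994, §4.2.3 (4.110)] -/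
def hopT (j : Fin 3) : Matrix (ColourSite L) (ColourSite L) ℂ :=
  Matrix.of fun p q => if q.1 = p.1 + Pi.single j 1 then
    (U (sliceSite p.1, j.succ) : Matrix (Fin 3) (Fin 3) ℂ) p.2 q.2 else 0

omit [NeZero L] in
/-- Entries of `T_j`. [folklore] -/
theorem hopT_apply (j : Fin 3) (p q : ColourSite L) :
    hopT U j p q = if q.1 = p.1 + Pi.single j 1 then
      (U (sliceSite p.1, j.succ) : Matrix (Fin 3) (Fin 3) ℂ) p.2 q.2 else 0 := rfl

/-- **`T_j` is unitary** (`U ∈ SU(3)`). [folklore] -/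
theorem conjTranspose_hopT_mul_self (j : Fin 3) : (hopT U j)ᴴ * hopT U j = 1 := by
  ext q q'
  have hUU : ∀ y : TorusSite 3 L, ∑ a, star ((U (sliceSite y, j.succ) : Matrix (Fin 3) (Fin 3) ℂ) a q.2) *
      (U (sliceSite y, j.succ) : Matrix (Fin 3) (Fin 3) ℂ) a q'.2 = if q.2 = q'.2 then 1 else 0 := by
    intro y
    set A : 𝔾 := U (sliceSite y, j.succ)
    have h1 : (((A⁻¹ : 𝔾) : Matrix (Fin 3) (Fin 3) ℂ) * (A : Matrix (Fin 3) (Fin 3) ℂ)) = 1 := by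
      rw [← Submonoid.coe_mul, inv_mul_cancel, Submonoid.coe_one]
    have h2 := congrFun (congrFun h1 q.2) q'.2
    rw [Matrix.mul_apply, Matrix.one_apply] at h2
    simp only [star_specialUnitary_apply]
    exact h2
  rw [Matrix.mul_apply, Fintype.sum_prod_type, Finset.sum_eq_single (q.1 - Pi.single j 1)]
  · simp only [Matrix.conjTranspose_apply, hopT_apply, sub_add_cancel, if_true]
    by_cases hq : q'.1 = q.1
    · simp only [hq, if_true, hUU, Matrix.one_apply]
      by_cases h2 : q = q'
      · subst h2; simp
      · have h2' : q.2 ≠ q'.2 := fun h => h2 (Prod.ext hq.symm h)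
        simp [h2, h2']
    · simp only [hq, if_false, mul_zero, Finset.sum_const_zero, Matrix.one_apply]
      rw [if_neg (fun h => hq (congrArg Prod.fst h).symm)]
  · intro y _ hy
    refine Finset.sum_eq_zero fun a _ => ?_
    have hne : ¬ q.1 = y + Pi.single j 1 := fun h => hy (by rw [h, add_sub_cancel_right])
    simp [Matrix.conjTranspose_apply, hopT_apply, hne]
  · exact fun h => absurd (Finset.mem_univ _) h

/-- **The matrix `B` of the slice** (Montvay–Münster (4.110)) in its manifestly positive form
`B = (m+1)·1 + ½ Σ_j (1 − T_j)ᴴ(1 − T_j)`. [cite: MontvayMunster1994, §4.2.3 (4.110)] -/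
def sliceB (m : ℝ) : Matrix (ColourSite L) (ColourSite L) ℂ :=
  Matrix.diagonal (fun _ => ((m + 1 : ℝ) : ℂ)) + (1 / 2 : ℂ) • ∑ j, (1 - hopT U j)ᴴ * (1 - hopT U j)

/-- **`B` is positive definite for `m > −1`** (Montvay–Münster, text after (4.110)). [cite: MontvayMunster1994, §4.2.3 (4.110)] -/
theorem posDef_sliceB {m : ℝ} (hm : -1 < m) : (sliceB U m).PosDef := by
  refine Matrix.PosDef.add_posSemidef (Matrix.PosDef.diagonal fun _ => ?_) ?_
  · exact Complex.zero_lt_real.2 (by linarith)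
  · refine Matrix.PosSemidef.smul (Matrix.posSemidef_sum _ fun j _ => ?_) (by
      rw [one_div]; exact (inv_pos.2 (by norm_num : (0:ℂ) < 2)).le)
    exact Matrix.posSemidef_conjTranspose_mul_self _

/-- The expanded square `(1 − T)ᴴ(1 − T) = 2 − T − Tᴴ` for unitary `T`. [folklore] -/
theorem conjTranspose_one_sub_mul (j : Fin 3) :
    (1 - hopT U j)ᴴ * (1 - hopT U j) = 2 • (1 : Matrix (ColourSite L) (ColourSite L) ℂ) - hopT U j - (hopT U j)ᴴ := by
  rw [Matrix.conjTranspose_sub, Matrix.conjTranspose_one, sub_mul, mul_sub, mul_sub, one_mul, one_mul,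
    Matrix.mul_one, conjTranspose_hopT_mul_self, two_smul]
  abel

/-- **Entries of `B`**: `B_{pq} = (m+4)δ_{pq} − ½ Σ_j ((T_j)_{pq} + conj (T_j)_{qp})`. [cite: MontvayMunster1994, §4.2.3 (4.110)] -/
theorem sliceB_apply (m : ℝ) (p q : ColourSite L) :
    sliceB U m p q = (if p = q then ((m + 4 : ℝ) : ℂ) else 0) -
      (1 / 2 : ℂ) * ∑ j, (hopT U j p q + star (hopT U j q p)) := by
  simp only [sliceB, conjTranspose_one_sub_mul, Matrix.add_apply, Matrix.smul_apply, Matrix.sum_apply,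
    Matrix.sub_apply, Matrix.smul_apply, Matrix.one_apply, Matrix.conjTranspose_apply, Matrix.diagonal_apply,
    smul_eq_mul, Finset.sum_sub_distrib, Finset.sum_add_distrib, Finset.sum_const, Finset.card_univ,
    Fintype.card_fin]
  split_ifs <;> push_cast <;> ring

variable (mq : Fin Nf → ℝ)

open SliceIdx

/-- **The slice coupling** on `SliceIdx`: flavour- and spin-diagonal, `2B_f` on the `ψ`-type upper
variables (`r < 2`) and `2B_fᵀ` on the `ψ̄`-type ones (`r ≥ 2`); the negative of the matrix `A'` of
the slice weight `exp(Σ l A' u)` (identified with the slice block of the rotated action in the sequel). [cite: MontvayMunster1994, §4.2.3 (4.109)–(4.110)] -/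
def sliceK : Matrix (SliceIdx Nf L) (SliceIdx Nf L) ℂ := Matrix.of fun j k =>
  if j.flav = k.flav ∧ j.spin = k.spin then
    2 * (if (j.spin).val < 2 then sliceB U (mq j.flav) (j.site, j.col) (k.site, k.col)
      else sliceB U (mq j.flav) (k.site, k.col) (j.site, j.col))
  else 0

/-- Entries of `sliceK`. [folklore] -/
theorem sliceK_apply (j k : SliceIdx Nf L) : sliceK U mq j k =
    if j.flav = k.flav ∧ j.spin = k.spin then
      2 * (if (j.spin).val < 2 then sliceB U (mq j.flav) (j.site, j.col) (k.site, k.col)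
        else sliceB U (mq j.flav) (k.site, k.col) (j.site, j.col))
    else 0 := rfl

/-- The spin–flavour blocks of `sliceK`. [folklore] -/
def sliceKBlock (p : Fin Nf × Fin 4) : Matrix (ColourSite L) (ColourSite L) ℂ :=
  (2 : ℂ) • (if (p.2).val < 2 then sliceB U (mq p.1) else (sliceB U (mq p.1))ᵀ)

/-- The regrouping of a slice index as (colour-site, (flavour, spin)). [folklore] -/
def sliceRegroup (k : SliceIdx Nf L) : ColourSite L × (Fin Nf × Fin 4) := ((k.site, k.col), (k.flav, k.spin))

omit [NeZero L] in
/-- `sliceRegroup` is injective. [folklore] -/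
theorem sliceRegroup_injective : Function.Injective (sliceRegroup (Nf := Nf) (L := L)) := by
  intro k k' h
  simp only [sliceRegroup, Prod.mk.injEq] at h
  exact ext' h.2.1 h.1.1 h.1.2 h.2.2

/-- `sliceK` is the block-diagonal matrix of its blocks, regrouped. [folklore] -/
theorem sliceK_eq_submatrix :
    sliceK U mq = (Matrix.blockDiagonal (sliceKBlock U mq)).submatrix sliceRegroup sliceRegroup := by
  ext j k
  rw [Matrix.submatrix_apply, sliceRegroup, sliceRegroup, Matrix.blockDiagonal_apply', sliceK_apply]
  by_cases h : j.flav = k.flav ∧ j.spin = k.spin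
  · have h' : (j.flav, j.spin) = (k.flav, k.spin) := Prod.ext h.1 h.2
    rw [if_pos h, if_pos h', sliceKBlock, Matrix.smul_apply, smul_eq_mul]
    split_ifs <;> rfl
  · have h' : ¬ (j.flav, j.spin) = (k.flav, k.spin) := fun e => h (Prod.mk.injEq _ _ _ _ ▸ e :)
    rw [if_neg h, if_neg h']

/-- **A block-diagonal matrix with positive definite blocks is positive definite.** [folklore] -/
theorem posDef_blockDiagonal {o n : Type*} [Fintype o] [DecidableEq o] [Fintype n] [DecidableEq n]
    {M : o → Matrix n n ℂ} (hM : ∀ k, (M k).PosDef) : (Matrix.blockDiagonal M).PosDef := by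
  refine Matrix.PosDef.of_dotProduct_mulVec_pos ?_ fun x hx => ?_
  · rw [Matrix.IsHermitian, Matrix.blockDiagonal_conjTranspose]
    exact congrArg _ (funext fun k => (hM k).isHermitian)
  · have hsplit : star x ⬝ᵥ (Matrix.blockDiagonal M *ᵥ x) =
        ∑ k, star (fun i => x (i, k)) ⬝ᵥ (M k *ᵥ fun i => x (i, k)) := by
      simp only [dotProduct, Matrix.mulVec, Fintype.sum_prod_type, Matrix.blockDiagonal_apply',
        Pi.star_apply]
      rw [Finset.sum_comm]
      refine Finset.sum_congr rfl fun k _ => Finset.sum_congr rfl fun i _ => ?_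
      congr 1
      rw [Finset.sum_comm]
      refine (Finset.sum_eq_single k (fun k' _ hk' => ?_) (fun h => absurd (Finset.mem_univ _) h)).trans ?_
      · simp [Ne.symm hk']
      · simp
    rw [hsplit]
    obtain ⟨⟨i₀, k₀⟩, hx0⟩ : ∃ p, x p ≠ 0 := by
      by_contra h
      push Not at h
      exact hx (funext h)
    have hk₀ : (fun i => x (i, k₀)) ≠ 0 := fun h => hx0 (congrFun h i₀)
    refine Finset.sum_pos' (fun k _ => ?_) ⟨k₀, Finset.mem_univ _, (hM k₀).dotProduct_mulVec_pos hk₀⟩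
    exact (hM k).posSemidef.dotProduct_mulVec_nonneg _

/-- **The slice coupling is positive definite for `m_f > −1`.** [cite: MontvayMunster1994, §4.2.3 (4.110)] -/
theorem posDef_sliceK (hm : ∀ f, -1 < mq f) : (sliceK U mq).PosDef := by
  rw [sliceK_eq_submatrix]
  refine (posDef_blockDiagonal fun p => ?_).submatrix sliceRegroup_injective
  unfold sliceKBlock
  refine Matrix.PosDef.smul ?_ (by norm_num : (0:ℂ) < 2)
  split_ifs
  · exact posDef_sliceB U (hm p.1)
  · exact (posDef_sliceB U (hm p.1)).transpose

/-- Its determinant is a unit. [folklore] -/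
theorem isUnit_det_sliceK (hm : ∀ f, -1 < mq f) : IsUnit (sliceK U mq).det :=
  (Matrix.isUnit_iff_isUnit_det _).1 (posDef_sliceK U mq hm).isUnit

/-- The determinant of `−K` is a unit. [folklore] -/
theorem isUnit_det_neg_sliceK (hm : ∀ f, -1 < mq f) : IsUnit (-sliceK U mq).det := by
  rw [Matrix.det_neg]
  exact ((isUnit_neg_one.pow _)).mul (isUnit_det_sliceK U mq hm)

/-- Its inverse is positive semidefinite. [folklore] -/
theorem posSemidef_inv_sliceK (hm : ∀ f, -1 < mq f) : (sliceK U mq)⁻¹.PosSemidef :=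
  (posDef_sliceK U mq hm).inv.posSemidef

/-- The transpose of its inverse is positive semidefinite. [folklore] -/
theorem posSemidef_inv_sliceK_transpose (hm : ∀ f, -1 < mq f) : ((sliceK U mq)⁻¹)ᵀ.PosSemidef :=
  (posSemidef_inv_sliceK U mq hm).transpose

/-- `−(−K)⁻¹ = K⁻¹`. [folklore] -/
theorem neg_inv_neg_sliceK (hm : ∀ f, -1 < mq f) : -(-sliceK U mq)⁻¹ = (sliceK U mq)⁻¹ := by
  have h : (-(sliceK U mq)⁻¹) * (-sliceK U mq) = 1 := by
    rw [neg_mul_neg, Matrix.nonsing_inv_mul _ (isUnit_det_sliceK U mq hm)]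
  rw [Matrix.inv_eq_left_inv h, neg_neg]

end Coupling

/-! ## Two generic lemmas on images of basis monomials -/

section Generic

variable {ι ι' : Type*} [LinearOrder ι] [Fintype ι] [LinearOrder ι'] [Fintype ι']

/-- A product of DISTINCT generators, in any order, is `±` the basis monomial of their set. [folklore] -/
theorem list_prod_map_gen_eq_smul (l : List ι') (hl : l.Nodup) :
    ∃ n : ℕ, (l.map (gen ℂ)).prod = ((-1 : ℂ) ^ n) • grassmannBasis ℂ ι' l.toFinset := by
  induction l with
  | nil => exact ⟨0, by simp⟩
  | cons a l ih =>
    obtain ⟨n, hn⟩ := ih (List.nodup_cons.1 hl).2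
    have ha : a ∉ l.toFinset := fun h => (List.nodup_cons.1 hl).1 (List.mem_toFinset.1 h)
    refine ⟨n + (l.toFinset.filter (· < a)).card, ?_⟩
    rw [List.map_cons, List.prod_cons, hn, mul_smul_comm, gen_mul_grassmannBasis_of_not_mem ℂ ha, smul_smul,
      ← pow_add, List.toFinset_cons, add_comm]

/-- A product of scaled elements: `∏ (cᵢ • xᵢ) = (∏ cᵢ) • ∏ xᵢ`. [folklore] -/
theorem list_prod_map_smul {κ A : Type*} [Ring A] [Algebra ℂ A] (l : List κ) (c : κ → ℂ) (x : κ → A) :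
    (l.map fun i => c i • x i).prod = (l.map c).prod • (l.map x).prod := by
  induction l with
  | nil => simp
  | cons a l ih => rw [List.map_cons, List.prod_cons, ih, List.map_cons, List.map_cons, List.prod_cons,
      List.prod_cons, smul_mul_smul_comm]

/-- **An algebra map sending generators to non-zero multiples of distinct generators sends basis
monomials to non-zero multiples of basis monomials.** [folklore] -/
theorem map_grassmannBasis_eq_smul_of_gen (f : GrassmannAlgebra ℂ ι →ₐ[ℂ] GrassmannAlgebra ℂ ι') (g : ι → ι')
    (c : ι → ℂ) (hg : Function.Injective g) (hc : ∀ i, c i ≠ 0) (hf : ∀ i, f (gen ℂ i) = c i • gen ℂ (g i))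
    (T : Finset ι) :
    ∃ a : ℂ, a ≠ 0 ∧ f (grassmannBasis ℂ ι T) = a • grassmannBasis ℂ ι' (T.image g) := by
  have hnd : ((Finset.sort T).map g).Nodup := (Finset.sort_nodup _ _).map hg
  obtain ⟨n, hn⟩ := list_prod_map_gen_eq_smul ((Finset.sort T).map g) hnd
  refine ⟨((Finset.sort T).map c).prod * (-1) ^ n, mul_ne_zero ?_ (pow_ne_zero _ (by norm_num)), ?_⟩
  · exact List.prod_ne_zero fun h => by
      obtain ⟨w, -, hw⟩ := List.mem_map.1 h
      exact hc w hw
  · have himg : ((Finset.sort T).map g).toFinset = T.image g := by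
      ext z
      simp only [List.mem_toFinset, List.mem_map, Finset.mem_sort, Finset.mem_image]
    rw [List.map_map] at hn
    have h2 : (Finset.sort T).map (⇑f ∘ gen ℂ) = (Finset.sort T).map (fun i => c i • (gen ℂ ∘ g) i) :=
      List.map_congr_left fun i _ => hf i
    rw [grassmannBasis_eq_prod_map_gen, map_list_prod, List.map_map, h2, list_prod_map_smul, hn, smul_smul, himg]

end Generic

/-! ## The top pairing through the substitution: `∫ θ_P θ_N φ(y) = C ∫ y`, `C ≠ 0` -/

section TopPairing

open SliceIdx

/-- The generator onto which `φ` sends an abstract generator: `ψ̄_k ↦ σ(emb k)`, `ψ_k ↦ emb k`. [folklore] -/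
def phiGen (w : SliceIdx Nf L ⊕ₗ SliceIdx Nf L) : FermiIdx Nf L ⊕ₗ FermiIdx Nf L :=
  match ofLex w with
  | Sum.inl k => reflGen (emb k)
  | Sum.inr k => emb k

/-- The coefficient picked up: `ε(emb k)` on `ψ̄_k`, `1` on `ψ_k`. [folklore] -/
def phiCoef (w : SliceIdx Nf L ⊕ₗ SliceIdx Nf L) : ℂ :=
  match ofLex w with
  | Sum.inl k => genSign (emb k)
  | Sum.inr _ => 1

/-- `φ` on a basis vector, through `phiGen`/`phiCoef`. [folklore] -/
theorem slicePhiVec_eq (w : SliceIdx Nf L ⊕ₗ SliceIdx Nf L) :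
    slicePhiVec w = phiCoef w • Pi.single (phiGen w) 1 := by
  rcases h : ofLex w with k | k
  · have hw : w = toLex (Sum.inl k) := by rw [← h, toLex_ofLex]
    subst hw; rfl
  · have hw : w = toLex (Sum.inr k) := by rw [← h, toLex_ofLex]
    subst hw
    simp [slicePhiVec, phiCoef, phiGen]

/-- **`φ(gen w) = phiCoef w • gen (phiGen w)`.** [folklore] -/
theorem map_slicePhi_gen (w : SliceIdx Nf L ⊕ₗ SliceIdx Nf L) :
    ExteriorAlgebra.map slicePhi (gen ℂ w) = phiCoef w • gen ℂ (phiGen w) := by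
  rw [gen, ExteriorAlgebra.map_apply_ι, slicePhi_single, slicePhiVec_eq, map_smul, gen]

/-- The signs `ε` are non-zero. [folklore] -/
theorem genSign_ne_zero (w : FermiIdx Nf L ⊕ₗ FermiIdx Nf L) : genSign w ≠ 0 := by
  unfold genSign spinSign
  generalize idxSpin (genIdx w) = r
  fin_cases r <;> simp

/-- The coefficients `phiCoef` are non-zero. [folklore] -/
theorem phiCoef_ne_zero (w : SliceIdx Nf L ⊕ₗ SliceIdx Nf L) : phiCoef w ≠ 0 := by
  rcases h : ofLex w with k | k
  · have hw : w = toLex (Sum.inl k) := by rw [← h, toLex_ofLex]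
    subst hw; exact genSign_ne_zero _
  · have hw : w = toLex (Sum.inr k) := by rw [← h, toLex_ofLex]
    subst hw; exact one_ne_zero

/-- `phiGen` of a `ψ̄`-slot is a lower slice generator. [folklore] -/
theorem phiGen_inl_mem (k : SliceIdx Nf L) : phiGen (toLex (Sum.inl k)) ∈ lowerGens Nf L :=
  reflGen_mem_lowerGens (emb_mem_upperGens k)

/-- `phiGen` of a `ψ`-slot is an upper slice generator. [folklore] -/
theorem phiGen_inr_mem (k : SliceIdx Nf L) : phiGen (toLex (Sum.inr k)) ∈ upperGens Nf L :=
  emb_mem_upperGens k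

/-- Upper and lower slice generators are disjoint. [folklore] -/
theorem disjoint_upperGens_lowerGens : Disjoint (upperGens Nf L) (lowerGens Nf L) := by
  rw [Finset.disjoint_left]
  intro w hu hl
  exact (mem_lowerGens.1 hl).2 (mem_upperGens.1 hu).2

/-- The slice is the disjoint union of the upper and lower generators. [folklore] -/
theorem zeroGens_eq_upper_union_lower : zeroGens Nf L = upperGens Nf L ∪ lowerGens Nf L := by
  ext w
  simp only [mem_zeroGens, Finset.mem_union, mem_upperGens, mem_lowerGens]
  tauto

/-- `phiGen` is injective. [folklore] -/
theorem phiGen_injective : Function.Injective (phiGen (Nf := Nf) (L := L)) := by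
  intro w w' h
  rcases hw : ofLex w with k | k <;> rcases hw' : ofLex w' with k' | k'
  · have e : w = toLex (Sum.inl k) := by rw [← hw, toLex_ofLex]
    have e' : w' = toLex (Sum.inl k') := by rw [← hw', toLex_ofLex]
    subst e e'
    have := reflGen_injective (h : reflGen (emb k) = reflGen (emb k'))
    rw [emb_injective this]
  · have e : w = toLex (Sum.inl k) := by rw [← hw, toLex_ofLex]
    have e' : w' = toLex (Sum.inr k') := by rw [← hw', toLex_ofLex]
    subst e e'
    exact absurd (phiGen_inr_mem k') (h ▸ Finset.disjoint_right.1 disjoint_upperGens_lowerGens (phiGen_inl_mem k))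
  · have e : w = toLex (Sum.inr k) := by rw [← hw, toLex_ofLex]
    have e' : w' = toLex (Sum.inl k') := by rw [← hw', toLex_ofLex]
    subst e e'
    exact absurd (phiGen_inr_mem k) (h.symm ▸ Finset.disjoint_right.1 disjoint_upperGens_lowerGens (phiGen_inl_mem k'))
  · have e : w = toLex (Sum.inr k) := by rw [← hw, toLex_ofLex]
    have e' : w' = toLex (Sum.inr k') := by rw [← hw', toLex_ofLex]
    subst e e'
    rw [emb_injective (h : emb k = emb k')]

/-- Every slice generator is a `phiGen w`. [folklore] -/
theorem exists_phiGen_eq {z : FermiIdx Nf L ⊕ₗ FermiIdx Nf L} (hz : z ∈ zeroGens Nf L) : ∃ w, phiGen w = z := by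
  rw [zeroGens_eq_upper_union_lower, Finset.mem_union] at hz
  rcases hz with hz | hz
  · obtain ⟨k, rfl⟩ := exists_emb_eq hz
    exact ⟨toLex (Sum.inr k), rfl⟩
  · have hz' : reflGen z ∈ upperGens Nf L := by
      rw [mem_lowerGens] at hz
      rw [mem_upperGens, genTimeT_reflGen, if_pos hz.1, isUpper_reflGen]
      exact ⟨rfl, hz.2⟩
    obtain ⟨k, hk⟩ := exists_emb_eq hz'
    refine ⟨toLex (Sum.inl k), ?_⟩
    show reflGen (emb k) = z
    rw [hk, reflGen_reflGen]

/-- **The image of `phiGen` is the slice.** [folklore] -/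
theorem image_phiGen_univ : Finset.univ.image (phiGen (Nf := Nf) (L := L)) = zeroGens Nf L := by
  ext z
  simp only [Finset.mem_image, Finset.mem_univ, true_and]
  constructor
  · rintro ⟨w, rfl⟩
    rcases h : ofLex w with k | k
    · have e : w = toLex (Sum.inl k) := by rw [← h, toLex_ofLex]
      subst e
      rw [zeroGens_eq_upper_union_lower, Finset.mem_union]
      exact Or.inr (phiGen_inl_mem k)
    · have e : w = toLex (Sum.inr k) := by rw [← h, toLex_ofLex]
      subst e
      rw [zeroGens_eq_upper_union_lower, Finset.mem_union]
      exact Or.inl (phiGen_inr_mem k)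
  · exact exists_phiGen_eq

/-- **`φ` of a basis monomial** is a non-zero multiple of the basis monomial of its `phiGen`-image. [folklore] -/
theorem map_slicePhi_grassmannBasis (T : Finset (SliceIdx Nf L ⊕ₗ SliceIdx Nf L)) :
    ∃ c : ℂ, c ≠ 0 ∧ ExteriorAlgebra.map slicePhi (grassmannBasis ℂ _ T) =
      c • grassmannBasis ℂ (FermiIdx Nf L ⊕ₗ FermiIdx Nf L) (T.image phiGen) :=
  map_grassmannBasis_eq_smul_of_gen (ExteriorAlgebra.map slicePhi) phiGen phiCoef phiGen_injective phiCoef_ne_zero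
    map_slicePhi_gen T

/-- **The top-pairing functional `y ↦ ∫ θ_P θ_N y`** (`P = posGens`, `N = negGens`). [folklore] -/
def topLam : FermiAlg Nf L →ₗ[ℂ] ℂ :=
  (berezin ℂ (FermiIdx Nf L ⊕ₗ FermiIdx Nf L)).comp
    (LinearMap.mulLeft ℂ (grassmannBasis ℂ _ (posGens Nf L) * grassmannBasis ℂ _ (negGens Nf L)))

/-- `topLam` applied. [folklore] -/
theorem topLam_apply (y : FermiAlg Nf L) :
    topLam y = berezin ℂ _ (grassmannBasis ℂ _ (posGens Nf L) * grassmannBasis ℂ _ (negGens Nf L) * y) := rfl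

/-- `topLam ∘ φ` kills the non-top abstract monomials. [folklore] -/
theorem topLam_map_slicePhi_basis_of_ne {T : Finset (SliceIdx Nf L ⊕ₗ SliceIdx Nf L)} (hT : T ≠ Finset.univ) :
    topLam (ExteriorAlgebra.map slicePhi (grassmannBasis ℂ _ T)) = 0 := by
  obtain ⟨c, -, hc⟩ := map_slicePhi_grassmannBasis T
  rw [hc, map_smul, topLam_apply, berezin_basis_mul_basis_mul_basis_eq_zero, smul_zero]
  obtain ⟨w, hw⟩ : ∃ w, w ∉ T := by
    by_contra h
    push Not at h
    exact hT (Finset.eq_univ_of_forall h)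
  intro huniv
  have hz : phiGen w ∈ posGens Nf L ∪ negGens Nf L ∪ T.image phiGen := huniv ▸ Finset.mem_univ _
  have hz0 : phiGen w ∈ zeroGens Nf L := image_phiGen_univ (Nf := Nf) (L := L) ▸ Finset.mem_image_of_mem _ (Finset.mem_univ w)
  rw [zeroGens_eq_compl, Finset.mem_compl] at hz0
  rcases Finset.mem_union.1 hz with h | h
  · exact hz0 h
  · obtain ⟨w', hw', he⟩ := Finset.mem_image.1 h
    exact hw (phiGen_injective he ▸ hw')

variable (Nf L) in
/-- **The top-pairing constant** `C = ∫ θ_P θ_N φ(θ_univ)`. [folklore] -/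
def topConst : ℂ := topLam (ExteriorAlgebra.map slicePhi (grassmannBasis ℂ (SliceIdx Nf L ⊕ₗ SliceIdx Nf L) Finset.univ))

/-- **`∫ θ_P θ_N φ(y) = C ∫ y`** for every abstract `y` (the hypothesis `hlam` of
`map_pairing_gaussian_eq`). [folklore] -/
theorem topLam_map_slicePhi (y : GrassmannAlgebra ℂ (SliceIdx Nf L ⊕ₗ SliceIdx Nf L)) :
    topLam (ExteriorAlgebra.map slicePhi y) = topConst Nf L * berezin ℂ (SliceIdx Nf L ⊕ₗ SliceIdx Nf L) y := by
  conv_lhs => rw [← (grassmannBasis ℂ _).sum_repr y]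
  rw [map_sum, map_sum, Finset.sum_eq_single Finset.univ]
  · rw [map_smul, map_smul, smul_eq_mul, mul_comm, topConst]
    -- `berezin` is, definitionally, the top coordinate functional
    congr 1
  · intro T _ hT; simp only [map_smul, topLam_map_slicePhi_basis_of_ne hT, smul_zero]
  · exact fun h => absurd (Finset.mem_univ _) h

/-- **`C ≠ 0`.** [folklore] -/
theorem topConst_ne_zero : topConst Nf L ≠ 0 := by
  obtain ⟨c, hc, hmap⟩ := map_slicePhi_grassmannBasis (Nf := Nf) (L := L) Finset.univ
  have hU : ∀ W : Finset (FermiIdx Nf L ⊕ₗ FermiIdx Nf L), (∀ w, w ∈ W) →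
      berezin ℂ _ (grassmannBasis ℂ _ W) = 1 := fun W h => by
    rw [Finset.eq_univ_of_forall h]; exact berezin_grassmannBasis_univ ℂ
  rw [topConst, hmap, map_smul, smul_eq_mul, topLam_apply, image_phiGen_univ,
    grassmannBasis_mul_grassmannBasis_of_disjoint ℂ disjoint_posGens_negGens, smul_mul_assoc, map_smul,
    grassmannBasis_mul_grassmannBasis_of_disjoint ℂ (by rw [zeroGens_eq_compl]; exact disjoint_compl_right),
    map_smul, hU _ (fun w => by
      by_cases hw : w ∈ posGens Nf L ∪ negGens Nf L
      · exact Finset.mem_union_left _ hw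
      · exact Finset.mem_union_right _ ((mem_zeroGens_iff_not_mem w).2 (by simpa [Finset.mem_union] using hw)))]
  simp only [smul_eq_mul, mul_one, ne_eq, mul_eq_zero, Int.cast_eq_zero, Units.ne_zero, or_self, hc,
    not_false_eq_true]

/-- `Θ'` is an involution. [folklore] -/
theorem fermiThetaRot_fermiThetaRot (y : FermiAlg Nf L) : fermiThetaRot (fermiThetaRot y) = y := by
  rw [fermiThetaRot_apply, fermiThetaRot_apply, spinRot_spinUnrot, torusTheta_torusTheta, spinUnrot_spinRot]

/-- **`Θ' θ_P = c_N θ_N` with `c_N ≠ 0`** (the constant of `exists_fermiThetaRot_basis_posGens` does not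
vanish, `Θ'` being an involution). [folklore] -/
theorem exists_fermiThetaRot_basis_posGens_ne (hL : Odd L) : ∃ cN : ℂ, cN ≠ 0 ∧
    fermiThetaRot (grassmannBasis ℂ _ (posGens Nf L)) = cN • grassmannBasis ℂ _ (negGens Nf L) := by
  obtain ⟨cN, hcN⟩ := exists_fermiThetaRot_basis_posGens (Nf := Nf) hL
  refine ⟨cN, fun h0 => ?_, hcN⟩
  rw [h0, zero_smul] at hcN
  have := fermiThetaRot_fermiThetaRot (grassmannBasis ℂ _ (posGens Nf L))
  rw [hcN, (fermiThetaRot (Nf := Nf) (L := L)).map_zero] at this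
  exact (grassmannBasis ℂ (FermiIdx Nf L ⊕ₗ FermiIdx Nf L)).ne_zero _ this.symm

/-! ### Expansion of an element supported on the upper generators along `φ(ψ_I)` -/

/-- **An element supported on the upper slice generators is `Σ_I c_I φ(ψ_I)`** with
`c_I = [θ_{emb I}]x` (the form required by `map_pairing_gaussian_eq`). [folklore] -/
theorem eq_sum_coord_smul_map_psiProd {x : FermiAlg Nf L}
    (hx : x ∈ spectatorSubalgebra ℂ (upperGens Nf L)ᶜ) :
    x = ∑ I : Finset (SliceIdx Nf L), (grassmannBasis ℂ _).repr x (I.image emb) •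
      ExteriorAlgebra.map slicePhi (psiProd (SliceIdx Nf L) I) := by
  simp only [map_slicePhi_psiProd]
  conv_lhs => rw [← (grassmannBasis ℂ _).sum_repr x]
  symm
  rw [← Finset.sum_subset (Finset.subset_univ ((upperGens Nf L).powerset)) (fun s _ hs => by
    rw [repr_eq_zero_of_mem_spectatorSubalgebra_of_not_disjoint hx, zero_smul]
    rw [Finset.mem_powerset] at hs
    intro hd
    exact hs fun w hw => by
      by_contra hwU
      exact Finset.disjoint_left.1 hd hw (Finset.mem_compl.2 hwU))]
  refine Finset.sum_bij' (fun I _ => I.image emb) (fun s _ => s.preimage emb emb_injective.injOn) ?_ ?_ ?_ ?_ ?_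
  · intro I _
    rw [Finset.mem_powerset, upperGens_eq_image]
    exact Finset.image_subset_image (Finset.subset_univ I)
  · intro s _; exact Finset.mem_univ _
  · intro I _
    ext k
    rw [Finset.mem_preimage, Finset.mem_image]
    exact ⟨fun ⟨k', hk', he⟩ => emb_injective he ▸ hk', fun hk => ⟨k, hk, rfl⟩⟩
  · intro s hs
    rw [Finset.mem_powerset, upperGens_eq_image] at hs
    ext w
    rw [Finset.mem_image]
    constructor
    · rintro ⟨k, hk, rfl⟩
      exact Finset.mem_preimage.1 hk
    · intro hw
      obtain ⟨k, -, rfl⟩ := Finset.mem_image.1 (hs hw)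
      exact ⟨k, Finset.mem_preimage.2 hw, rfl⟩
  · intro I _; rfl

end TopPairing

end

end Literature.MathematicalPhysics.QuantumFieldTheory
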